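import Literature.AlgebraicGeometry.Resolution.GeneralizedStabilityFiniteRank
import HarnessLib

/-!
# Generalized stability for `K(t)`: rank one (Kuhlmann 2010, Lemma 5.4, statement (R4))

Topic: `Literature/AlgebraicGeometry/Resolution` (valued function fields). Fifth layer of the
decomposition of the named fact `Kuhlmann2010Stability` (`ValuationDefect.lean`) = F.-V. Kuhlmann,
*Elimination of ramification I: The generalized stability theorem*, Trans. AMS 362 (2010)
5697–5727 = arXiv:1003.5678, **Thm. 1.1**, along the printed proof (§5). After
`GeneralizedStability.lean` (Cor. 2.6, Cor. 2.16), `GeneralizedStabilityRational.lean`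
(Lemma 5.1), `GeneralizedStabilityTrdegOne.lean` (Lemma 5.2) and
`GeneralizedStabilityFiniteRank.lean` (Lemma 5.3), the theorem over a trivially valued ground
field rests on Cor. 2.25 (`Kuhlmann2010DefectlessDescent`), on the proof of Lemma 5.3
(`Kuhlmann2010AlgClosedFiniteRankReduction`) and on `Kuhlmann2010StabilityAlgClosedFiniteRank`
= (R3) for `F = K(t)` with `t` value-transcendental over an algebraically closed `K`, `(F, v)`
of finite rank (the fundamental inequality being proved, `GeneralizedStabilityProofs.lean`).
The fourth step of §5 (p. 18 of the arXiv version) is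

> **Lemma 5.4.** To prove (R3), it suffices to prove
> (R4) Every valued function field of rank 1 and of transcendence degree 1 without
> transcendence defect over an algebraically closed ground field is a defectless field.
> *Proof.* Let `(F,v)` satisfy the assumptions of (R3). Then `(F,v)` must also have finite rank
> … Let `v = w₁∘…∘wₙ` be the decomposition of `v` into valuations `wᵢ` of rank 1. By Lemma 2.1,
> every `Kw₁∘…∘wᵢ` is an algebraically closed field. By a repeated application of Lemma 2.8,
> `(F|K,w₁)` and all `(Fw₁∘…∘wᵢ | Kw₁∘…∘wᵢ, w_{i+1})` are valued function fields without
> transcendence defect. Hence (R4) yields that every `(Fw₁∘…∘wᵢ, w_{i+1})` is a defectless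
> field. Now a repeated application of Lemma 2.17 shows that `(F,v)` itself is a defectless
> field.

Lemma 5.4 is henselization-free: `GeneralizedStabilityRankOneProofs.lean` PROVES it for the case
at hand — `Kuhlmann2010StabilityAlgClosedFiniteRank` from the two facts below — by induction on
the rank, with Lemma 2.17 (`IsDefectlessField.of_le_of_residue`, `DefectlessComposite.lean`,
PROVED) and the lemmas of `GeneralizedStabilityFiniteRankLemmas.lean` (Lemma 2.8 for `K(t)`:
under the rank-one coarsening `w₁` the generator `t` is value-transcendental, or `t/d` is
residue-transcendental; Lemma 2.5: `Fw₁ = Kw₁` resp. `Fw₁ = Kw₁(t̄)`; Lemma 2.1: `Kw₁` is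
algebraically closed). What remains is (R4) itself, which this file vendors as NAMED FACTS in
the two special cases the induction consumes (weaker than print): a valued RATIONAL function
field `K(t)` of rank one over an algebraically closed `K` whose generator is
value-transcendental, resp. residue-transcendental (§2.5: "a value-transcendental element
`x ∈ F`, i.e., its value `vx` is rationally independent over `vK`, or … a residue-transcendental
element `x ∈ F`, i.e., `vx = 0` and the residue `x̄` is transcendental over `K̄`. In both cases,
`x` is transcendental over `K` by Lemma 2.5, hence `F|K(x)` is finite" — so `K(t)|K` has
transcendence degree `1` and no transcendence defect, Cor. 2.6). Their printed proof
(pp. 18–20) is the heart of the paper: Thm. 2.14 (pass to the henselization `K(t)^h`), the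
ramification group is a `p`-group so that `E.F^r|F^r` is a tower of normal extensions of
degree `p`, Lemma 2.27, Prop. 2.18, Cor. 4.2 (the Artin–Schreier and Kummer normal forms of
§4, Props. 4.5, 4.6), Prop. 3.1, Lemma 5.5, Lemma 2.13 — henselizations and ramification
theory of valued fields, which Mathlib does not have.

## Content

* `Kuhlmann2010StabilityRankOneValueTranscendental` — NAMED FACT: (R4) for `K(t)` of rank one
  over an algebraically closed `K`, `t` value-transcendental.
* `Kuhlmann2010StabilityRankOneResidueTranscendental` — NAMED FACT: (R4) for `K(t)` of rank one
  over an algebraically closed `K`, `t ∈ F°` with residue transcendental over `Kv`.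

With them (`GeneralizedStabilityRankOneProofs.lean`): `Kuhlmann2010StabilityAlgClosedFiniteRank`
is PROVED, and `Kuhlmann2010Stability` follows from `Kuhlmann2010DefectlessDescent` (Cor. 2.25),
`Kuhlmann2010AlgClosedFiniteRankReduction` (Lemma 5.3) and these two rank-one facts.

## Sources

* F.-V. Kuhlmann, *Elimination of ramification I: The generalized stability theorem*, Trans.
  Amer. Math. Soc. 362 (2010) 5697–5727 = arXiv:1003.5678: §1 (defectless fields), §2.1 (rank:
  "It has rank 1 (i.e., its only convex subgroups are `{0}` and `vK`) if and only if `vK` is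
  archimedean"; Lemma 2.1, Lemma 2.5, Cor. 2.6, Lemma 2.8), §2.5 (value- and
  residue-transcendental elements), §5 (Lemma 5.4, (R3), (R4), proof of (R4), Lemma 5.5;
  pp. 18–20).

## Rendering notes

* As in the previous layers: an extension of valued fields is `[Algebra K F]` plus
  `O : ValuationSubring F` (`K° = O.comap (algebraMap K F)`); "`F = K(t)`" is
  `IntermediateField.adjoin K {t} = ⊤`; "`t` value-transcendental over `K`" is
  `∀ n ≥ 1, ∀ c : K, v(t)^n ≠ v(c)`; "`t` residue-transcendental" is `t ∈ F°` with `residue t`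
  transcendental over `Kv = residueSubfield K F° ⊆ Fv` (then `vt = 0` automatically).
* "rank 1" (§2.1: non-trivial convex subgroups ↔ non-zero prime ideals of `F°` ↔ proper
  overrings of `F°`) ↦ `O ≠ ⊤` and the only overrings of `O` are `O` and `⊤`, as in
  `CompositeValuations.lean` (`nonempty_rankOne_of_overrings` turns this into Mathlib's
  `Valuation.RankOne`).
-/

noncomputable section

open IsLocalRing

namespace Literature.AlgebraicGeometry.Resolution

universe u

/-! ### (R4) for rational function fields of rank one (named facts) -/

/-- NAMED FACT — **Kuhlmann 2010, (R4) for a rank-one valued rational function field with a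
value-transcendental generator over an algebraically closed field** (§5, Lemma 5.4: "(R4) Every
valued function field of rank 1 and of transcendence degree 1 without transcendence defect over
an algebraically closed ground field is a defectless field"; §2.1: "[`(K,v)`] has rank 1 (i.e.,
its only convex subgroups are `{0}` and `vK`) if and only if `vK` is archimedean"; §2.5: "a
value-transcendental element `x ∈ F`, i.e., its value `vx` is rationally independent over `vK` …
`x` is transcendental over `K` by Lemma 2.5"). Statement: `K` algebraically closed with the
valuation ring `F° ∩ K`, `F = K(t)` with `n·vt ∉ vK` for all `n ≥ 1` (so `(F|K, v)` is a valued
rational function field of transcendence degree `1 = rr vF/vK` without transcendence defect,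
Lemma 2.5 / Cor. 2.6), and `(F, v)` of rank one: `F° ≠ F` and the only overrings of `F°` are
`F°` and `F`; then `(F, F°)` is a defectless field. Its printed proof (pp. 18–20: Thm. 2.14,
ramification theory — `F^r`, `p`-groups —, Lemma 2.27, Prop. 2.18, Cor. 4.2 = the
Artin–Schreier and Kummer normal forms of §4, Prop. 3.1, Lemma 5.5, Lemma 2.13) rests on
henselizations of valued fields, which Mathlib does not have. Users take
`(h : Kuhlmann2010StabilityRankOneValueTranscendental)`.
[cite: Kuhlmann2010, Section 5, Lemma 5.4 (R4)] -/
def Kuhlmann2010StabilityRankOneValueTranscendental : Prop :=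
  ∀ (K F : Type u) [Field K] [Field F] [Algebra K F] [IsAlgClosed K] (O : ValuationSubring F)
    (t : F), O ≠ ⊤ → (∀ S : ValuationSubring F, O ≤ S → S = O ∨ S = ⊤) →
    (∀ n : ℕ, 0 < n → ∀ c : K, O.valuation t ^ n ≠ O.valuation (algebraMap K F c)) →
    IntermediateField.adjoin K ({t} : Set F) = ⊤ → IsDefectlessField F O

/-- NAMED FACT — **Kuhlmann 2010, (R4) for a rank-one valued rational function field with a
residue-transcendental generator over an algebraically closed field** (§5, Lemma 5.4, (R4) as
above; §2.5: "a residue-transcendental element `x ∈ F`, i.e., `vx = 0` and the residue `x̄` is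
transcendental over `K̄`. In both cases, `x` is transcendental over `K` by Lemma 2.5, hence
`F|K(x)` is finite"). Statement: `K` algebraically closed with the valuation ring `F° ∩ K`,
`F = K(t)` with `t ∈ F°` whose residue is transcendental over `Kv ⊆ Fv` (so `(F|K, v)` is a
valued rational function field of transcendence degree `1 = trdeg Fv|Kv` without transcendence
defect, Lemma 2.5 / Cor. 2.6), and `(F, v)` of rank one (`F° ≠ F`, the only overrings of `F°`
are `F°` and `F`); then `(F, F°)` is a defectless field. Printed proof as for the
value-transcendental case (pp. 18–20), via henselizations. Users take
`(h : Kuhlmann2010StabilityRankOneResidueTranscendental)`.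
[cite: Kuhlmann2010, Section 5, Lemma 5.4 (R4)] -/
def Kuhlmann2010StabilityRankOneResidueTranscendental : Prop :=
  ∀ (K F : Type u) [Field K] [Field F] [Algebra K F] [IsAlgClosed K] (O : ValuationSubring F)
    (t : O), O ≠ ⊤ → (∀ S : ValuationSubring F, O ≤ S → S = O ∨ S = ⊤) →
    Transcendental (residueSubfield K O) (residue O t) →
    IntermediateField.adjoin K ({(t : F)} : Set F) = ⊤ → IsDefectlessField F O

end Literature.AlgebraicGeometry.Resolution
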